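import Summits.AtomisticToContinuum.HydrodynamicLimit.Theorems.StiffCollisionalRelaxationAprioriBoundsFibreDefsR4
import Summits.AtomisticToContinuum.HydrodynamicLimit.Theorems.StiffCollisionalRelaxationAprioriBoundsFibreDeficitSlabBounds
import Summits.AtomisticToContinuum.HydrodynamicLimit.Theorems.StiffCollisionalRelaxationAprioriBoundsFibreLinStatL1Fields
import Summits.AtomisticToContinuum.HydrodynamicLimit.Theorems.StiffCollisionalRelaxationAprioriBoundsTruncationTools
import HarnessLib

/-!
# Hydrodynamics in the mean on `[0, t]` from the hydrodynamic limit at each time (line `fibre-deficit-transfer`, skeleton r4,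
glue of the stub `stub_linStatL1`, part 2; crux `AprioriBounds`, stmt-AtomisticToContinuum-14827)

Support file (`--supports stmt-AtomisticToContinuum-14827`) of the stub-worker of `stub_linStatL1` — the OPEN, conjunct-strength
dynamical input of the rate-free (i)-chain of skeleton r4: `LinStatL1VanishAt`, i.e. `∫₀ᵗ E_N|ℓ_s ∘ Φ_s| ds → 0` for the linear
statistic `ℓ_s(w) = (N+1)⁻¹∑ᵢ Λ(s,xᵢ)·(1,vᵢ,|vᵢ|²/2) − m_s` of the entropy-gradient tilt `Λ = (λ₀, u/θ, −1/θ)` of the classical Euler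
solution (vocabulary `…AprioriBoundsFibreDefs(R4)`).  This file derives it from the WEAKEST CONCEIVABLE dynamical hypothesis:

* `linStatL1_of_hydroLimitOn` (registered sub-goal): for `σ ≤ 1/2`, nice profiles, `t ≥ 0`, fields `(ρ, u, θ)` jointly continuous on
  the slab `[0,t] × 𝕋³` with `θ > 0` and a jointly continuous density multiplier `λ₀` (the hypotheses of the lever `stub_klLever`),
  **convergence in probability of the three empirical fields at every `s ∈ [0, t]`** (`TendstoHydroFieldsAt … s`, the conclusion of
  the conjunct `HydrodynamicLimit` restricted to `[0, t]`) **plus the exponential energy moment `EnergyMomentAt`** (landed producer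
  `stub_energyMoment`) **imply `LinStatL1VanishAt`**;
* `linStatL1_of_hydroLimitOn_Ico` (registered sub-goal): the same with the field convergence only at every `s ∈ [0, t)` (the
  endpoint is Lebesgue-null; this is the form the conjunct Statement delivers when run with horizon `T := t`);
* `linStatL1_of_hydroRate`: the RATED input `LinearHydroRateAt` of skeleton r2 (plus `EnergyMomentAt`) implies it as well.

## Proof

(1) Part 1 (`…FibreLinStatL1Fields`): `|ℓ_s| ≤ |dev_ρ| + ∑ₗ ‖devₗ‖ + |dev_E|`, so `P_N(|ℓ_s ∘ Φ_s| > δ) → 0` for every `δ > 0`.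
(2) UNIFORM INTEGRABILITY (`LinStatL1.lintegral_abs_linStat_flow_le`, exponential-Markov split): `|ℓ_s| ≤ A₁ + D·E/(N+1)` on the slab
(`exists_abs_linStat_le`), energy conservation on good orbits and `E e^{κE} ≤ e^{(N+1)/κ}` give, once `κ(N+1) ≥ 1`,
`E|ℓ_s ∘ Φ_s| ≤ β + (A₁ + 2D/κ²)·P(|ℓ_s ∘ Φ_s| > β) + D e^{2/κ²} e^{−(N+1)/κ}` (all `β ≥ 0`): `E|ℓ_s ∘ Φ_s| → 0` at each `s`, and
(β = 0) `E|ℓ_s ∘ Φ_s| ≤ A₁ + 2D/κ² + D e^{2/κ²}` uniformly.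
(3) DOMINATED CONVERGENCE in `s` on `[0, t]` (`AdiabatCeiling.tendsto_setLIntegral_Icc_of_dominated`), the mean being a.e.-measurable
in `s` by the joint measurability of the flow on its good set (`LinStatL1.aemeasurable_lintegral_abs_linStat_flow'`).

No new definitions, no named facts; axioms `propext`, `Classical.choice`, `Quot.sound`.
-/

noncomputable section

open MeasureTheory Filter Set Topology
open scoped ENNReal

namespace Summit.AtomisticToContinuum.HydrodynamicLimit.Theorems.FibreDeficitTransfer

open Literature.MathematicalPhysics.KineticTheory Literature.Analysis.FluidPDE
open Summit.AtomisticToContinuum.HydrodynamicLimit.Theorems.AprioriBoundsNegative (PartOneAt PartTwoAt)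
open Summit.AtomisticToContinuum.HydrodynamicLimit.Theorems.VisitLedgerUpscattering (Cfg Flow Flows NiceProfiles)

namespace LinStatL1

variable {σ : ℝ} {ρ θ : ℝ → T3 → ℝ} {u : ℝ → T3 → V3} {t : ℝ}

/-! ## Uniform integrability: the mean of the linear statistic along the flow -/

/-- **The exponential-Markov bound for the mean of `|ℓ_s ∘ Φ_s|`** under the local Gibbs law (energy conservation on good orbits +
the exponential energy moment at the level `m = 2/κ²`): for every `β ≥ 0`, once `κ(N+1) ≥ 1`,
`E|ℓ_s ∘ Φ_s| ≤ β + (A₁ + 2D/κ²)·P{β < |ℓ_s ∘ Φ_s|} + D e^{2/κ²} e^{−(N+1)/κ}` (lower Lebesgue integrals). -/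
theorem lintegral_abs_linStat_flow_le {a₀ θ₀ : T3 → ℝ} {u₀ : T3 → V3} (hP : NiceProfiles a₀ θ₀ u₀) (hσ2 : σ ≤ 1 / 2)
    {N : ℕ} (Φ : Flow σ N) {s A₁ D κ β : ℝ} (hA₁ : 0 ≤ A₁) (hD : 0 ≤ D) (hκN : 1 ≤ κ * ((N : ℝ) + 1)) (hβ : 0 ≤ β)
    (hℓ : ∀ w : Cfg N, |linStat σ ρ θ u s w| ≤ A₁ + D * (configEnergy w / ((N : ℝ) + 1)))
    (hmeas : Measurable fun w : Cfg N => linStat σ ρ θ u s w)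
    (hmom : ∫⁻ z, ENNReal.ofReal (Real.exp (κ * configEnergy z)) ∂(localGibbsLaw σ a₀ u₀ θ₀ N Φ) ≤
      ENNReal.ofReal (Real.exp (((N : ℝ) + 1) / κ))) :
    ∫⁻ z, ENNReal.ofReal |linStat σ ρ θ u s (Φ.flow s z)| ∂(localGibbsLaw σ a₀ u₀ θ₀ N Φ) ≤
      ENNReal.ofReal β +
        ENNReal.ofReal (A₁ + D * (2 / κ ^ 2)) * localGibbsLaw σ a₀ u₀ θ₀ N Φ {z | β < |linStat σ ρ θ u s (Φ.flow s z)|} +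
        ENNReal.ofReal (D * (Real.exp (2 / κ ^ 2) * Real.exp (-(((N : ℝ) + 1) / κ)))) := by
  obtain ⟨ha, hθ₀, hu₀, ha0, hθ0⟩ := hP
  haveI := isProbabilityMeasure_localGibbsLaw ha hθ₀ hu₀ ha0 hθ0 hσ2 N Φ
  set P := localGibbsLaw σ a₀ u₀ θ₀ N Φ with hPdef
  set m : ℝ := 2 / κ ^ 2 with hm_def
  have hm : 0 ≤ m := by positivity
  set B : Set (Cfg N) := {z | β < |linStat σ ρ θ u s (Φ.flow s z)|} with hB
  have hBm : MeasurableSet B := measurableSet_lt measurable_const ((hmeas.comp (Φ.measurable_flow s)).abs)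
  set c : ℝ := Real.exp (-((κ * ((N : ℝ) + 1) - 1) * m)) with hc
  have hpt := fun z => abs_linStat_flow_le_split Φ (β := β) (κ := κ) hD hm hβ hκN hℓ z
  have hEm : Measurable fun z : Cfg N => ENNReal.ofReal (Real.exp (κ * configEnergy (Φ.flow s z))) := by
    have h : Measurable fun w : Cfg N => configEnergy w := by
      unfold configEnergy
      exact measurable_const.mul (Finset.measurable_sum _ fun i _ => (measurable_pi_apply i).snd.norm.pow_const 2)
    exact ((h.comp (Φ.measurable_flow s)).const_mul κ).exp.ennreal_ofReal
  have hle : ∫⁻ z, ENNReal.ofReal |linStat σ ρ θ u s (Φ.flow s z)| ∂P ≤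
      ENNReal.ofReal β + ENNReal.ofReal (A₁ + D * m) * P B +
        ENNReal.ofReal (D * c) * ∫⁻ z, ENNReal.ofReal (Real.exp (κ * configEnergy (Φ.flow s z))) ∂P := by
    calc ∫⁻ z, ENNReal.ofReal |linStat σ ρ θ u s (Φ.flow s z)| ∂P
        ≤ ∫⁻ z, ENNReal.ofReal β + ENNReal.ofReal (A₁ + D * m) * B.indicator 1 z +
            ENNReal.ofReal (D * c) * ENNReal.ofReal (Real.exp (κ * configEnergy (Φ.flow s z))) ∂P := by
          refine lintegral_mono fun z => ?_
          have h := hpt z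
          have h1 : (0 : ℝ) ≤ (A₁ + D * m) * B.indicator 1 z :=
            mul_nonneg (by positivity) (Set.indicator_nonneg (fun _ _ => zero_le_one) _)
          have h2 : (0 : ℝ) ≤ D * (c * Real.exp (κ * configEnergy (Φ.flow s z))) := by positivity
          calc ENNReal.ofReal |linStat σ ρ θ u s (Φ.flow s z)|
              ≤ ENNReal.ofReal (β + (A₁ + D * m) * B.indicator 1 z + D * (c * Real.exp (κ * configEnergy (Φ.flow s z)))) :=
                ENNReal.ofReal_le_ofReal h
            _ = ENNReal.ofReal β + ENNReal.ofReal ((A₁ + D * m) * B.indicator 1 z) +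
                  ENNReal.ofReal (D * (c * Real.exp (κ * configEnergy (Φ.flow s z)))) := by
                rw [ENNReal.ofReal_add (by positivity) h2, ENNReal.ofReal_add hβ h1]
            _ = _ := by
                congr 1
                · congr 1
                  rw [ENNReal.ofReal_mul (by positivity)]
                  congr 1
                  by_cases hz : z ∈ B
                  · simp [indicator_of_mem hz]
                  · simp [indicator_of_notMem hz]
                · rw [← mul_assoc, ENNReal.ofReal_mul (by positivity)]
      _ = ENNReal.ofReal β + ENNReal.ofReal (A₁ + D * m) * P B +
            ENNReal.ofReal (D * c) * ∫⁻ z, ENNReal.ofReal (Real.exp (κ * configEnergy (Φ.flow s z))) ∂P := by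
          have hm1 : Measurable fun z : Cfg N => ENNReal.ofReal β + ENNReal.ofReal (A₁ + D * m) * B.indicator 1 z :=
            Measurable.const_add (Measurable.const_mul (measurable_one.indicator hBm) _) _
          rw [lintegral_add_left hm1, lintegral_add_left measurable_const, lintegral_const, measure_univ, mul_one,
            lintegral_const_mul _ (measurable_one.indicator hBm), lintegral_indicator_one hBm,
            lintegral_const_mul _ hEm]
  -- energy conservation a.e.: the moment through the flow is the time-zero moment
  have hgood : ∀ᵐ z ∂P, z ∈ Φ.good := by
    have hac : P ≪ liouville (Torus.geometry (Fin 3)) (N + 1) (hsDiameter σ N) := by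
      rw [hPdef, localGibbsLaw, particleLaw_eq]; exact withDensity_absolutelyContinuous _ _
    exact hac.ae_le Φ.ae_mem_good
  have hflowmom : ∫⁻ z, ENNReal.ofReal (Real.exp (κ * configEnergy (Φ.flow s z))) ∂P =
      ∫⁻ z, ENNReal.ofReal (Real.exp (κ * configEnergy z)) ∂P := by
    refine lintegral_congr_ae ?_
    filter_upwards [hgood] with z hz
    rw [Φ.configEnergy_flow hz s]
  rw [hflowmom] at hle
  -- numerical values: `c · e^{(N+1)/κ} = e^{m} e^{−(N+1)/κ}` at `m = 2/κ²`
  have hκ : 0 < κ := by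
    by_contra hκ0
    push Not at hκ0
    have : κ * ((N : ℝ) + 1) ≤ 0 := mul_nonpos_of_nonpos_of_nonneg hκ0 (by positivity)
    linarith
  have hcexp : c * Real.exp (((N : ℝ) + 1) / κ) = Real.exp m * Real.exp (-(((N : ℝ) + 1) / κ)) := by
    rw [hc, ← Real.exp_add, ← Real.exp_add]
    congr 1
    rw [hm_def]
    field_simp
    ring
  refine hle.trans (add_le_add le_rfl ?_)
  calc ENNReal.ofReal (D * c) * ∫⁻ z, ENNReal.ofReal (Real.exp (κ * configEnergy z)) ∂P
      ≤ ENNReal.ofReal (D * c) * ENNReal.ofReal (Real.exp (((N : ℝ) + 1) / κ)) := mul_le_mul_right hmom _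
    _ = ENNReal.ofReal (D * (Real.exp m * Real.exp (-(((N : ℝ) + 1) / κ)))) := by
        rw [← ENNReal.ofReal_mul (mul_nonneg hD (Real.exp_pos _).le), mul_assoc, hcexp]

/-- **A uniform bound for the mean** (the split at `β = 0`): `E|ℓ_s ∘ Φ_s| ≤ A₁ + 2D/κ² + D e^{2/κ²}` once `κ(N+1) ≥ 1`. -/
theorem lintegral_abs_linStat_flow_le_const {a₀ θ₀ : T3 → ℝ} {u₀ : T3 → V3} (hP : NiceProfiles a₀ θ₀ u₀) (hσ2 : σ ≤ 1 / 2)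
    {N : ℕ} (Φ : Flow σ N) {s A₁ D κ : ℝ} (hA₁ : 0 ≤ A₁) (hD : 0 ≤ D) (hκN : 1 ≤ κ * ((N : ℝ) + 1))
    (hℓ : ∀ w : Cfg N, |linStat σ ρ θ u s w| ≤ A₁ + D * (configEnergy w / ((N : ℝ) + 1)))
    (hmeas : Measurable fun w : Cfg N => linStat σ ρ θ u s w)
    (hmom : ∫⁻ z, ENNReal.ofReal (Real.exp (κ * configEnergy z)) ∂(localGibbsLaw σ a₀ u₀ θ₀ N Φ) ≤
      ENNReal.ofReal (Real.exp (((N : ℝ) + 1) / κ))) :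
    ∫⁻ z, ENNReal.ofReal |linStat σ ρ θ u s (Φ.flow s z)| ∂(localGibbsLaw σ a₀ u₀ θ₀ N Φ) ≤
      ENNReal.ofReal (A₁ + D * (2 / κ ^ 2) + D * Real.exp (2 / κ ^ 2)) := by
  haveI := isProbabilityMeasure_localGibbsLaw hP.1 hP.2.1 hP.2.2.1 hP.2.2.2.1 hP.2.2.2.2 hσ2 N Φ
  have h := lintegral_abs_linStat_flow_le hP hσ2 Φ hA₁ hD hκN le_rfl hℓ hmeas hmom
  rw [ENNReal.ofReal_zero, zero_add] at h
  refine h.trans ?_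
  have h1 : 0 ≤ A₁ + D * (2 / κ ^ 2) := by positivity
  rw [ENNReal.ofReal_add h1 (by positivity)]
  refine add_le_add ?_ (ENNReal.ofReal_le_ofReal ?_)
  · calc ENNReal.ofReal (A₁ + D * (2 / κ ^ 2)) * localGibbsLaw σ a₀ u₀ θ₀ N Φ {z | 0 < |linStat σ ρ θ u s (Φ.flow s z)|}
        ≤ ENNReal.ofReal (A₁ + D * (2 / κ ^ 2)) * 1 := mul_le_mul_right prob_le_one _
      _ = _ := mul_one _
  · have hexp : Real.exp (-(((N : ℝ) + 1) / κ)) ≤ 1 := by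
      rw [Real.exp_le_one_iff, neg_nonpos]
      have hκ : 0 < κ * ((N : ℝ) + 1) := lt_of_lt_of_le one_pos hκN
      have hκ' : 0 < κ := pos_of_mul_pos_left hκ (by positivity)
      positivity
    calc D * (Real.exp (2 / κ ^ 2) * Real.exp (-(((N : ℝ) + 1) / κ))) ≤ D * (Real.exp (2 / κ ^ 2) * 1) := by gcongr
      _ = D * Real.exp (2 / κ ^ 2) := by rw [mul_one]

/-- **`L¹` convergence at a fixed time from convergence in probability** (the split, `P{β < |ℓ_s ∘ Φ_s|} → 0` for every `β > 0`,
`e^{−(N+1)/κ} → 0`): `E_N|ℓ_s ∘ Φ_s| → 0`. -/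
theorem tendsto_lintegral_abs_linStat_flow {a₀ θ₀ : T3 → ℝ} {u₀ : T3 → V3} (hP : NiceProfiles a₀ θ₀ u₀) (hσ2 : σ ≤ 1 / 2)
    (Φ : Flows σ) {s A₁ D κ : ℝ} (hA₁ : 0 ≤ A₁) (hD : 0 ≤ D) (hκ : 0 < κ)
    (hℓ : ∀ (N : ℕ) (w : Cfg N), |linStat σ ρ θ u s w| ≤ A₁ + D * (configEnergy w / ((N : ℝ) + 1)))
    (hmeas : ∀ N : ℕ, Measurable fun w : Cfg N => linStat σ ρ θ u s w)
    (hmom : ∀ N : ℕ, ∫⁻ z, ENNReal.ofReal (Real.exp (κ * configEnergy z)) ∂(localGibbsLaw σ a₀ u₀ θ₀ N (Φ N)) ≤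
      ENNReal.ofReal (Real.exp (((N : ℝ) + 1) / κ)))
    (hprob : ∀ β : ℝ, 0 < β → Tendsto (fun N => localGibbsLaw σ a₀ u₀ θ₀ N (Φ N)
      {z | β < |linStat σ ρ θ u s ((Φ N).flow s z)|}) atTop (𝓝 0)) :
    Tendsto (fun N => ∫⁻ z, ENNReal.ofReal |linStat σ ρ θ u s ((Φ N).flow s z)| ∂(localGibbsLaw σ a₀ u₀ θ₀ N (Φ N)))
      atTop (𝓝 0) := by
  -- the threshold `κ (N+1) ≥ 1`
  have hT : Tendsto (fun N : ℕ => (N : ℝ) + 1) atTop atTop := tendsto_atTop_add_const_right _ 1 tendsto_natCast_atTop_atTop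
  have hκN : ∀ᶠ N : ℕ in atTop, 1 ≤ κ * ((N : ℝ) + 1) := by
    have h := (hT.const_mul_atTop hκ).eventually_ge_atTop 1
    exact h
  -- the vanishing remainder
  have hrem : Tendsto (fun N : ℕ => ENNReal.ofReal (D * (Real.exp (2 / κ ^ 2) * Real.exp (-(((N : ℝ) + 1) / κ)))))
      atTop (𝓝 0) := by
    have h1 : Tendsto (fun N : ℕ => Real.exp (-(((N : ℝ) + 1) / κ))) atTop (𝓝 0) :=
      Real.tendsto_exp_neg_atTop_nhds_zero.comp (hT.atTop_div_const hκ)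
    have h2 := (h1.const_mul (Real.exp (2 / κ ^ 2))).const_mul D
    rw [mul_zero, mul_zero] at h2
    have h3 := ENNReal.tendsto_ofReal h2
    rwa [ENNReal.ofReal_zero] at h3
  refine ENNReal.tendsto_nhds_zero.2 fun ε hε => ?_
  rcases eq_top_or_lt_top ε with rfl | hεtop
  · exact Eventually.of_forall fun N => le_top
  have hε0 : 0 < ε.toReal := ENNReal.toReal_pos hε.ne' hεtop.ne
  set β : ℝ := ε.toReal / 2 with hβ
  have hβ0 : 0 < β := by positivity
  have hhalf : ENNReal.ofReal β = ε / 2 := by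
    rw [hβ, ENNReal.ofReal_div_of_pos two_pos, ENNReal.ofReal_toReal hεtop.ne, ENNReal.ofReal_ofNat]
  have hg : Tendsto (fun N : ℕ => ENNReal.ofReal (A₁ + D * (2 / κ ^ 2)) *
      localGibbsLaw σ a₀ u₀ θ₀ N (Φ N) {z | β < |linStat σ ρ θ u s ((Φ N).flow s z)|} +
      ENNReal.ofReal (D * (Real.exp (2 / κ ^ 2) * Real.exp (-(((N : ℝ) + 1) / κ))))) atTop (𝓝 0) := by
    have h1 := ENNReal.Tendsto.const_mul (a := ENNReal.ofReal (A₁ + D * (2 / κ ^ 2))) (hprob β hβ0)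
      (Or.inr ENNReal.ofReal_ne_top)
    rw [mul_zero] at h1
    simpa using h1.add hrem
  filter_upwards [hκN, ENNReal.tendsto_nhds_zero.1 hg (ε / 2) (ENNReal.half_pos hε.ne')] with N hN1 hN2
  calc ∫⁻ z, ENNReal.ofReal |linStat σ ρ θ u s ((Φ N).flow s z)| ∂(localGibbsLaw σ a₀ u₀ θ₀ N (Φ N))
      ≤ ENNReal.ofReal β + (ENNReal.ofReal (A₁ + D * (2 / κ ^ 2)) *
          localGibbsLaw σ a₀ u₀ θ₀ N (Φ N) {z | β < |linStat σ ρ θ u s ((Φ N).flow s z)|} +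
          ENNReal.ofReal (D * (Real.exp (2 / κ ^ 2) * Real.exp (-(((N : ℝ) + 1) / κ))))) := by
        rw [← add_assoc]
        exact lintegral_abs_linStat_flow_le hP hσ2 (Φ N) hA₁ hD hN1 hβ0.le (hℓ N) (hmeas N) (hmom N)
    _ ≤ ε / 2 + ε / 2 := by rw [hhalf]; exact add_le_add le_rfl hN2
    _ = ε := ENNReal.add_halves ε

/-! ## Measurability of the mean in the time variable -/

/-- The clamp `s ↦ max 0 (min t s)` onto `[0, t]`. -/
theorem clamp_mem_Icc (ht : 0 ≤ t) (s : ℝ) : max 0 (min t s) ∈ Icc 0 t :=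
  ⟨le_max_left _ _, max_le ht (min_le_left _ _)⟩

/-- A field continuous on the slab, read through the clamp, is globally jointly continuous. -/
theorem continuous_clamp {Y : Type*} [TopologicalSpace Y] {f : ℝ → T3 → Y}
    (hf : ContinuousOn (Function.uncurry f) (Icc 0 t ×ˢ univ)) (ht : 0 ≤ t) :
    Continuous fun p : ℝ × T3 => f (max 0 (min t p.1)) p.2 :=
  hf.comp_continuous (f := fun p : ℝ × T3 => (max 0 (min t p.1), p.2))
    ((continuous_const.max (continuous_const.min continuous_fst)).prodMk continuous_snd) fun p =>
      ⟨clamp_mem_Icc ht p.1, mem_univ _⟩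

/-- **Joint continuity of the clamped linear statistic** `(w, s) ↦ ℓ_{clamp s}(w)` (fields continuous on the slab, `θ > 0`). -/
theorem continuous_linStat_clamp' (hρc : ContinuousOn (Function.uncurry ρ) (Icc 0 t ×ˢ univ))
    (hθc : ContinuousOn (Function.uncurry θ) (Icc 0 t ×ˢ univ)) (huc : ContinuousOn (Function.uncurry u) (Icc 0 t ×ˢ univ))
    (ht : 0 ≤ t) (hθ : ∀ s ∈ Icc 0 t, ∀ x, 0 < θ s x)
    (hΛ : ContinuousOn (fun p : ℝ × T3 => lam0 σ (ρ p.1 p.2) (θ p.1 p.2) (u p.1 p.2)) (Icc 0 t ×ˢ univ)) (N : ℕ) :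
    Continuous fun q : Cfg N × ℝ => linStat σ ρ θ u (max 0 (min t q.2)) q.1 := by
  set c : ℝ → ℝ := fun s => max 0 (min t s) with hc
  have hcc : Continuous c := continuous_const.max (continuous_const.min continuous_id)
  have hθ' := continuous_clamp hθc ht
  have hu' := continuous_clamp huc ht
  have hρ' := continuous_clamp hρc ht
  have hΛ' : Continuous fun p : ℝ × T3 => lam0 σ (ρ (c p.1) p.2) (θ (c p.1) p.2) (u (c p.1) p.2) :=
    hΛ.comp_continuous (f := fun p : ℝ × T3 => (c p.1, p.2)) ((hcc.comp continuous_fst).prodMk continuous_snd)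
      fun p => ⟨clamp_mem_Icc ht p.1, mem_univ _⟩
  have hθne : ∀ p : ℝ × T3, θ (c p.1) p.2 ≠ 0 := fun p => (hθ _ (clamp_mem_Icc ht p.1) p.2).ne'
  have hexp : Continuous fun q : ℝ × (T3 × V3) => tiltExponent σ ρ θ u (c q.1) q.2 := by
    unfold tiltExponent
    have hsx : Continuous fun q : ℝ × (T3 × V3) => (q.1, q.2.1) := continuous_fst.prodMk continuous_snd.fst
    refine ((hΛ'.comp hsx).add (((hu'.comp hsx).inner continuous_snd.snd).div (hθ'.comp hsx) fun q => hθne (q.1, q.2.1))).sub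
      ((continuous_snd.snd.norm.pow 2).div (continuous_const.mul (hθ'.comp hsx)) fun q =>
        mul_ne_zero two_ne_zero (hθne (q.1, q.2.1)))
  have hmean : Continuous fun s : ℝ => tiltMean σ ρ θ u (c s) := by
    have hF : Continuous (Function.uncurry fun (s : ℝ) (x : T3) =>
        ρ (c s) x * (lam0 σ (ρ (c s) x) (θ (c s) x) (u (c s) x) + ‖u (c s) x‖ ^ 2 / (2 * θ (c s) x) - 3 / 2)) :=
      hρ'.mul ((hΛ'.add ((hu'.norm.pow 2).div (continuous_const.mul hθ') fun p => mul_ne_zero two_ne_zero (hθne p))).sub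
        continuous_const)
    have h := continuous_parametric_integral_of_continuous (μ := (volume : Measure T3)) hF isCompact_univ
    simp only [Measure.restrict_univ] at h
    exact h
  have hlin : (fun q : Cfg N × ℝ => linStat σ ρ θ u (c q.2) q.1) =
      fun q => ((N + 1 : ℕ) : ℝ)⁻¹ * (∑ i, tiltExponent σ ρ θ u (c q.2) (q.1 i)) - tiltMean σ ρ θ u (c q.2) := by
    funext q; rw [linStat_eq, tiltPot]
  rw [hlin]
  refine (continuous_const.mul (continuous_finsetSum _ fun i _ => ?_)).sub (hmean.comp continuous_snd)
  exact hexp.comp (continuous_snd.prodMk ((continuous_apply i).comp continuous_fst))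

/-- **The mean `s ↦ E_{μ₀}|ℓ_s ∘ Φ_s|` is a.e.-measurable on `[0, t]`** (joint measurability of the flow on its good set, Tonelli). -/
theorem aemeasurable_lintegral_abs_linStat_flow' {a₀ θ₀ : T3 → ℝ} {u₀ : T3 → V3} (hP : NiceProfiles a₀ θ₀ u₀) (hσ2 : σ ≤ 1 / 2)
    (hρc : ContinuousOn (Function.uncurry ρ) (Icc 0 t ×ˢ univ)) (hθc : ContinuousOn (Function.uncurry θ) (Icc 0 t ×ˢ univ))
    (huc : ContinuousOn (Function.uncurry u) (Icc 0 t ×ˢ univ)) (ht : 0 ≤ t) (hθ : ∀ s ∈ Icc 0 t, ∀ x, 0 < θ s x)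
    (hΛ : ContinuousOn (fun p : ℝ × T3 => lam0 σ (ρ p.1 p.2) (θ p.1 p.2) (u p.1 p.2)) (Icc 0 t ×ˢ univ)) (N : ℕ) (Φ : Flow σ N) :
    AEMeasurable (fun s => ∫⁻ z, ENNReal.ofReal |linStat σ ρ θ u s (Φ.flow s z)| ∂(localGibbsLaw σ a₀ u₀ θ₀ N Φ))
      (volume.restrict (Icc 0 t)) := by
  set ν : Measure ℝ := volume.restrict (Icc 0 t) with hν
  haveI : IsProbabilityMeasure (localGibbsLaw σ a₀ u₀ θ₀ N Φ) :=
    isProbabilityMeasure_localGibbsLaw hP.1 hP.2.1 hP.2.2.1 hP.2.2.2.1 hP.2.2.2.2 hσ2 N Φ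
  have hF : Measurable fun q : Cfg N × ℝ => ENNReal.ofReal |linStat σ ρ θ u (max 0 (min t q.2)) q.1| :=
    (continuous_linStat_clamp' hρc hθc huc ht hθ hΛ N).measurable.abs.ennreal_ofReal
  have hgood : localGibbsLaw σ a₀ u₀ θ₀ N Φ Φ.goodᶜ = 0 := by
    rw [localGibbsLaw_eq]
    exact (localGibbsMeasure_absolutelyContinuous σ _ _ _ N Φ) Φ.measure_compl_good
  have hprod := AdiabatCeiling.aemeasurable_comp_flow_prod₂ Φ hF hgood ν
  have hswap := hprod.prod_swap
  have h1 : AEMeasurable (fun s => ∫⁻ z, ENNReal.ofReal |linStat σ ρ θ u (max 0 (min t s)) (Φ.flow s z)|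
      ∂(localGibbsLaw σ a₀ u₀ θ₀ N Φ)) ν := hswap.lintegral_prod_right'
  refine h1.congr ?_
  rw [hν, Filter.EventuallyEq, ae_restrict_iff' measurableSet_Icc]
  refine ae_of_all _ fun s hs => ?_
  have hcs : max 0 (min t s) = s := by
    rw [min_eq_right hs.2, max_eq_right hs.1]
  simp only [hcs]

/-! ## Assembly -/

/-- **Hydrodynamics in the mean on `[0,t]` from convergence in probability of the linear statistic at each time `s < t`** (the
common core of the glues): fields continuous on the slab with `θ > 0` and a continuous density multiplier, `EnergyMomentAt`, and
`P_N{δ < |ℓ_s ∘ Φ_s|} → 0` for all `s ∈ [0,t)` and `δ > 0` imply `LinStatL1VanishAt` (the endpoint `{t}` is Lebesgue-null, so the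
pointwise limit is only needed for a.e. `s ∈ [0,t]`). -/
theorem linStatL1_of_tendsto_measure_Ico {a₀ θ₀ : T3 → ℝ} {u₀ : T3 → V3} {Φ : Flows σ} (hσ2 : σ ≤ 1 / 2)
    (hP : NiceProfiles a₀ θ₀ u₀) (ht : 0 ≤ t)
    (hρc : ContinuousOn (Function.uncurry ρ) (Icc 0 t ×ˢ univ)) (hθc : ContinuousOn (Function.uncurry θ) (Icc 0 t ×ˢ univ))
    (huc : ContinuousOn (Function.uncurry u) (Icc 0 t ×ˢ univ)) (hθ : ∀ s ∈ Icc 0 t, ∀ x, 0 < θ s x)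
    (hΛ : ContinuousOn (fun p : ℝ × T3 => lam0 σ (ρ p.1 p.2) (θ p.1 p.2) (u p.1 p.2)) (Icc 0 t ×ˢ univ))
    (hMom : EnergyMomentAt σ a₀ θ₀ u₀ Φ)
    (hprob : ∀ s ∈ Ico 0 t, ∀ δ : ℝ, 0 < δ → Tendsto (fun N => localGibbsLaw σ a₀ u₀ θ₀ N (Φ N)
      {z | δ < |linStat σ ρ θ u s ((Φ N).flow s z)|}) atTop (𝓝 0)) :
    LinStatL1VanishAt σ a₀ θ₀ u₀ ρ θ u Φ t := by
  obtain ⟨κ, hκ, hmom⟩ := hMom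
  obtain ⟨A₁, D, hA₁, hD, hℓ⟩ := exists_abs_linStat_le σ ρ θ u t hρc hθc huc ht hθ hΛ
  -- slice data
  have hmeas : ∀ s ∈ Icc 0 t, ∀ N : ℕ, Measurable fun w : Cfg N => linStat σ ρ θ u s w := fun s hs N =>
    measurable_linStat_slice s (continuous_slice hθc hs) (continuous_slice huc hs) (hθ s hs)
      (continuous_slice (f := fun s x => lam0 σ (ρ s x) (θ s x) (u s x)) hΛ hs) N
  -- the threshold `κ (N+1) ≥ 1` beyond `N₃`
  obtain ⟨N₃, hN₃⟩ := exists_nat_ge (1 / κ)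
  have hκN : ∀ n : ℕ, 1 ≤ κ * (((n + N₃ : ℕ) : ℝ) + 1) := by
    intro n
    have h1 : 1 / κ ≤ ((n + N₃ : ℕ) : ℝ) + 1 := by
      have : (N₃ : ℝ) ≤ ((n + N₃ : ℕ) : ℝ) := by exact_mod_cast Nat.le_add_left N₃ n
      linarith
    rw [div_le_iff₀ hκ] at h1
    linarith [mul_comm κ (((n + N₃ : ℕ) : ℝ) + 1)]
  set F : ℕ → ℝ → ℝ≥0∞ := fun N s =>
    ∫⁻ z, ENNReal.ofReal |linStat σ ρ θ u s ((Φ N).flow s z)| ∂(localGibbsLaw σ a₀ u₀ θ₀ N (Φ N)) with hF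
  -- pointwise limit in `s < t`, hence for a.e. `s ∈ [0, t]`
  have hlim : ∀ s ∈ Ico 0 t, Tendsto (fun N => F N s) atTop (𝓝 0) := fun s hs =>
    tendsto_lintegral_abs_linStat_flow hP hσ2 Φ hA₁ hD.le hκ (fun N w => hℓ s (Ico_subset_Icc_self hs) N w)
      (hmeas s (Ico_subset_Icc_self hs)) hmom (hprob s hs)
  have hlim' : ∀ᵐ s ∂(volume.restrict (Icc 0 t)), Tendsto (fun n => F (n + N₃) s) atTop (𝓝 0) := by
    rw [← Measure.restrict_congr_set (Ico_ae_eq_Icc (μ := (volume : Measure ℝ)) (a := 0) (b := t))]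
    exact (ae_restrict_iff' measurableSet_Ico).2 (ae_of_all _ fun s hs => (hlim s hs).comp (tendsto_add_atTop_nat N₃))
  -- uniform bound beyond `N₃`
  have hbd : ∀ n : ℕ, ∀ s ∈ Icc 0 t, F (n + N₃) s ≤ ENNReal.ofReal (A₁ + D * (2 / κ ^ 2) + D * Real.exp (2 / κ ^ 2)) :=
    fun n s hs => lintegral_abs_linStat_flow_le_const hP hσ2 (Φ (n + N₃)) hA₁ hD.le (hκN n) (fun w => hℓ s hs _ w)
      (hmeas s hs _) (hmom _)
  -- a.e.-measurability in `s`
  have hFm : ∀ N, AEMeasurable (F N) (volume.restrict (Icc 0 t)) := fun N =>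
    aemeasurable_lintegral_abs_linStat_flow' hP hσ2 hρc hθc huc ht hθ hΛ N (Φ N)
  -- dominated convergence for the shifted sequence, then unshift
  have hshift : Tendsto (fun n => ∫⁻ s in Icc 0 t, F (n + N₃) s) atTop (𝓝 0) :=
    AdiabatCeiling.tendsto_setLIntegral_Icc_of_dominated (fun n => F (n + N₃)) (fun n => hFm _)
      (fun n => (ae_restrict_iff' measurableSet_Icc).2 (ae_of_all _ (hbd n))) hlim'
  rw [LinStatL1VanishAt]
  exact (tendsto_add_atTop_iff_nat N₃).1 hshift

/-- The same with the limit hypothesis at every `s ∈ [0, t]`. -/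
theorem linStatL1_of_tendsto_measure {a₀ θ₀ : T3 → ℝ} {u₀ : T3 → V3} {Φ : Flows σ} (hσ2 : σ ≤ 1 / 2)
    (hP : NiceProfiles a₀ θ₀ u₀) (ht : 0 ≤ t)
    (hρc : ContinuousOn (Function.uncurry ρ) (Icc 0 t ×ˢ univ)) (hθc : ContinuousOn (Function.uncurry θ) (Icc 0 t ×ˢ univ))
    (huc : ContinuousOn (Function.uncurry u) (Icc 0 t ×ˢ univ)) (hθ : ∀ s ∈ Icc 0 t, ∀ x, 0 < θ s x)
    (hΛ : ContinuousOn (fun p : ℝ × T3 => lam0 σ (ρ p.1 p.2) (θ p.1 p.2) (u p.1 p.2)) (Icc 0 t ×ˢ univ))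
    (hMom : EnergyMomentAt σ a₀ θ₀ u₀ Φ)
    (hprob : ∀ s ∈ Icc 0 t, ∀ δ : ℝ, 0 < δ → Tendsto (fun N => localGibbsLaw σ a₀ u₀ θ₀ N (Φ N)
      {z | δ < |linStat σ ρ θ u s ((Φ N).flow s z)|}) atTop (𝓝 0)) :
    LinStatL1VanishAt σ a₀ θ₀ u₀ ρ θ u Φ t :=
  linStatL1_of_tendsto_measure_Ico hσ2 hP ht hρc hθc huc hθ hΛ hMom fun s hs => hprob s (Ico_subset_Icc_self hs)

end LinStatL1

open LinStatL1 in
/-- **GLUE `linStatL1_of_hydroLimitOn_Ico` (registered sub-goal of the crux; the a.e.-variant): the hydrodynamic limit in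
probability at every `s ∈ [0, t)` plus the exponential energy moment imply hydrodynamics in the mean on `[0, t]`.**  Same as
`linStatL1_of_hydroLimitOn` below but with the field convergence only on the half-open interval `Ico 0 t` — the form delivered by
the conjunct Statement `HydrodynamicLimit` run with horizon `T := t` (the endpoint `{t}` is null for `LinStatL1VanishAt`). -/
theorem linStatL1_of_hydroLimitOn_Ico : ∀ (σ : ℝ) (a₀ θ₀ : T3 → ℝ) (u₀ : T3 → V3) (ρ θ : ℝ → T3 → ℝ) (u : ℝ → T3 → V3) (Φ : (N : ℕ) → HardSphereFlow (Torus.geometry (Fin 3)) (hsDiameter σ N) (N + 1)) (t : ℝ), σ ≤ 1 / 2 → NiceProfiles a₀ θ₀ u₀ → 0 ≤ t → ContinuousOn (Function.uncurry ρ) (Icc 0 t ×ˢ univ) → ContinuousOn (Function.uncurry θ) (Icc 0 t ×ˢ univ) → ContinuousOn (Function.uncurry u) (Icc 0 t ×ˢ univ) → (∀ s ∈ Icc 0 t, ∀ x, 0 < θ s x) → ContinuousOn (fun p : ℝ × T3 => lam0 σ (ρ p.1 p.2) (θ p.1 p.2) (u p.1 p.2)) (Icc 0 t ×ˢ univ)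 → (∀ s ∈ Ico 0 t, TendstoHydroFieldsAt (fun N => localGibbsLaw σ a₀ u₀ θ₀ N (Φ N)) Φ ρ u θ s) → EnergyMomentAt σ a₀ θ₀ u₀ Φ → LinStatL1VanishAt σ a₀ θ₀ u₀ ρ θ u Φ t := by
  intro σ a₀ θ₀ u₀ ρ θ u Φ t hσ2 hP ht hρc hθc huc hθ hΛ hH hMom
  refine linStatL1_of_tendsto_measure_Ico hσ2 hP ht hρc hθc huc hθ hΛ hMom fun s hs δ hδ => ?_
  have hs' : s ∈ Icc 0 t := Ico_subset_Icc_self hs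
  exact tendsto_measure_lt_abs_linStat_flow s (continuous_slice hρc hs') (continuous_slice hθc hs') (continuous_slice huc hs')
    (hθ s hs') (continuous_slice (f := fun s x => lam0 σ (ρ s x) (θ s x) (u s x)) hΛ hs') (hH s hs) hδ

open LinStatL1 in
/-- **GLUE `linStatL1_of_hydroLimitOn` (registered sub-goal of the crux): the hydrodynamic limit on `[0, t]` in probability plus the
exponential energy moment imply hydrodynamics in the mean on `[0, t]`.**  For `σ ≤ 1/2`, nice profiles, `t ≥ 0`, fields `(ρ, u, θ)`
jointly continuous on `[0,t] × 𝕋³` with `θ > 0` and a jointly continuous density multiplier `λ₀`: if the three empirical fields of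
the evolved gas converge in probability at every `s ∈ [0, t]` (`TendstoHydroFieldsAt … s`, the conclusion of the conjunct
`HydrodynamicLimit` restricted to `[0, t]`) and `EnergyMomentAt σ a₀ θ₀ u₀ Φ` holds (landed `stub_energyMoment`), then
`LinStatL1VanishAt σ a₀ θ₀ u₀ ρ θ u Φ t`, i.e. `∫₀ᵗ E_N|ℓ_s ∘ Φ_s| ds → 0`. -/
theorem linStatL1_of_hydroLimitOn : ∀ (σ : ℝ) (a₀ θ₀ : T3 → ℝ) (u₀ : T3 → V3) (ρ θ : ℝ → T3 → ℝ) (u : ℝ → T3 → V3) (Φ : (N : ℕ) → HardSphereFlow (Torus.geometry (Fin 3)) (hsDiameter σ N) (N + 1)) (t : ℝ), σ ≤ 1 / 2 → NiceProfiles a₀ θ₀ u₀ → 0 ≤ t → ContinuousOn (Function.uncurry ρ) (Icc 0 t ×ˢ univ) → ContinuousOn (Function.uncurry θ) (Icc 0 t ×ˢ univ) → ContinuousOn (Function.uncurry u) (Icc 0 t ×ˢ univ) → (∀ s ∈ Icc 0 t, ∀ x, 0 < θ s x) → ContinuousOn (fun p : ℝ × T3 => lam0 σ (ρ p.1 p.2)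 (θ p.1 p.2) (u p.1 p.2)) (Icc 0 t ×ˢ univ) → (∀ s ∈ Icc 0 t, TendstoHydroFieldsAt (fun N => localGibbsLaw σ a₀ u₀ θ₀ N (Φ N)) Φ ρ u θ s) → EnergyMomentAt σ a₀ θ₀ u₀ Φ → LinStatL1VanishAt σ a₀ θ₀ u₀ ρ θ u Φ t := by
  intro σ a₀ θ₀ u₀ ρ θ u Φ t hσ2 hP ht hρc hθc huc hθ hΛ hH hMom
  exact linStatL1_of_hydroLimitOn_Ico σ a₀ θ₀ u₀ ρ θ u Φ t hσ2 hP ht hρc hθc huc hθ hΛ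
    (fun s hs => hH s (Ico_subset_Icc_self hs)) hMom

open LinStatL1 in
/-- **The rated input of skeleton r2 implies the rate-free input of skeleton r4**: under the same regularity hypotheses,
`LinearHydroRateAt ∧ EnergyMomentAt ⟹ LinStatL1VanishAt`. -/
theorem linStatL1_of_hydroRate : ∀ (σ : ℝ) (a₀ θ₀ : T3 → ℝ) (u₀ : T3 → V3) (ρ θ : ℝ → T3 → ℝ) (u : ℝ → T3 → V3) (Φ : (N : ℕ) → HardSphereFlow (Torus.geometry (Fin 3)) (hsDiameter σ N) (N + 1)) (t : ℝ), σ ≤ 1 / 2 → NiceProfiles a₀ θ₀ u₀ → 0 ≤ t → ContinuousOn (Function.uncurry ρ) (Icc 0 t ×ˢ univ) → ContinuousOn (Function.uncurry θ) (Icc 0 t ×ˢ univ) → ContinuousOn (Function.uncurry u) (Icc 0 t ×ˢ univ) → (∀ s ∈ Icc 0 t, ∀ x, 0 < θ s x) → ContinuousOn (fun p : ℝ × T3 => lam0 σ (ρ p.1 p.2) (θ p.1 p.2) (u p.1 p.2)) (Icc 0 t ×ˢ univ) → LinearHydroRateAt σ a₀ θ₀ u₀ ρ θ u Φ t → EnergyMomentAt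 σ a₀ θ₀ u₀ Φ → LinStatL1VanishAt σ a₀ θ₀ u₀ ρ θ u Φ t := by
  intro σ a₀ θ₀ u₀ ρ θ u Φ t hσ2 hP ht hρc hθc huc hθ hΛ hR hMom
  exact linStatL1_of_tendsto_measure hσ2 hP ht hρc hθc huc hθ hΛ hMom fun s hs δ hδ =>
    tendsto_measure_lt_abs_linStat_flow_of_rate hR hs hδ

end Summit.AtomisticToContinuum.HydrodynamicLimit.Theorems.FibreDeficitTransfer

end
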